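import Mathlib
import HarnessLib
import Summits.HubbardSuperconductivity.HubbardSuperconductivity.Theorems.KLProgrammeKLRegimeEngineTwoLegSpLegStepSplit

/-!
# K3 gen 8, ENGINE child `KLRegimeEngineV17F2` (stmt-HubbardSuperconductivity-20437), stub (e) `stub_twoLeg_step` (and (M) at `n = 0`),
# row C1 (the CUTOFF nested leg `hcut`) at EVERY scale: the ONE-STEP SPLIT DOOR — the `M`-leg twin of k3c5-p2's `…EngineTwoLegSpLegStepSplit`
# (p547263), i.e. the step of this lane's strong induction `cutLeg_allScales_of_step_hist` (p528616) from TWO per-scale point estimates and one budget line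

Cell `gate-hubbard-kl`, seat hubbard-kl-r2d-p1 (g7; owner of stub (e)'s consumer side).  Row C1 of the (e)/(M) closers compares the scale-`n` readings of
ONE spatial volume `L₁` at two Matsubara cutoffs `M₁ ≤ M₂`, EACH AT ITS OWN FLOW FRAME: `ν_n^{(i)} = S_i(k_F^{K_i}(θ))`,
`S_i = symInterp L₁ (klLocSelfEnergyRe L₁ Mᵢ … K_i n)`, `K_i = klFlowFrameU L₁ Mᵢ β U μ n`.  `cutLeg_allScales_of_step_hist` reduces the leg at all scales
`≤ N` to STEP(n): thresholds + histories below `n` + the leg's own rates `a m / L₁` at `m < n` + the DERIVED frame comparability `|K₁(q) − K₂(q)| ≤ F_n/L₁`,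
`F_n := Σ_{m<n} a m` ⟹ `|ν_n^{(1)}(θ) − ν_n^{(2)}(θ)| ≤ a n / L₁`.  Exactly as for the spatial leg, STEP(n) follows from

* (R) a gradient bound `b` of the reading `evalM S₁` on the frame-distance tube `{|e_{K₁}(q)| ≤ F_n/L₁}` (the reading point moves by
  `≤ frameDist K₁ K₂/klCurveD` along the ray — p1b's `abs_apply_klFermiPoint_sub_le_of_frames_of_tube`, frame sizes from `frame_sizes_of_frameOK_explicit`);
* (D) the two-cutoff defect of the two readings AT ONE COMMON POINT, `|S₁(k_F^{K₂}θ) − S₂(k_F^{K₂}θ)| ≤ d/L₁` (the VL lanes' Grassmann-level output read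
  through `symInterp`; at `n = 0` k3c4-p2's `…TwoCutoffScaleZeroLeg`);
* the budget line `b·F_n/klCurveD + d ≤ a n`.

§1 `abs_klLocalPart_flow_sub_le_commonPoint_add_vols` — the pointwise split (R) for the flow readings of two ARBITRARY volumes `(L₁,M₁)`, `(L₂,M₂)`
   (p547263 §2 is the case `M₁ = M₂`; this is the case-free form, same proof).
§2 `cutLeg_step_of_pointDefect_hist` — STEP(n) of the cutoff leg for an arbitrary comparison history; `cutLeg_step_of_pointDefect_sepTubeGradient_hist` —
   (R) in row B2's currency (separated shell-tube gradient `m₁′` at `(L₁, M₁, K₁)`, `b := m₁′ + 4/3·Gfr₁U²`) under `F_n ≤ Λ_n·L`.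
§3 `cutLeg_allScales_of_pointDefects_hist` — the leg at every `n ≤ N` (`cutLeg_allScales_of_step_hist` ∘ §2).
§4 `cutLeg_allScales_of_pointDefects_V17F2` / `_V17F2_pkg` (quarter budget `a m := Q.CL β m/4`: literally the `hcut` hypothesis of
   `twoLegSlot_of_jets_…_nestedLegs` / `EngineV8.stub_twoLeg_step_of_residuals*`) and `_V17F2_rates` (PRIVATE rates `a n ≤ Q.CL β n/4` — the induction
   vehicle at deep scales, k3c5-p2's COUNT in `…SpLegStepSplitRates`).

Proofs only (compositions of cited tree lemmas); no definitions; nothing about the model is asserted; nothing asserts superconductivity.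
References: BGM 2006 §2.4 Lemma 2.1 (2.40), (2.23) [cite: BenfattoGiulianiMastropietro2006].
-/

noncomputable section

namespace Summit.HubbardSuperconductivity.HubbardSuperconductivity.Theorems.EngineV8

set_option linter.dupNamespace false -- summit = problem name (single-conjunct summit), D-0017

open Real Finset Set Literature.MathematicalPhysics.QuantumLattice Literature.Probability.LatticeModels
open Literature.MathematicalPhysics.QuantumLattice.BandSectorCounting
open Summit.HubbardSuperconductivity.HubbardSuperconductivity.Theorems.KLProgrammeLegKernels
open Summit.HubbardSuperconductivity.HubbardSuperconductivity.Theorems.DispersionFlow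
open Summit.HubbardSuperconductivity.HubbardSuperconductivity.Theorems.PerturbedFermiCurve
open Summit.HubbardSuperconductivity.HubbardSuperconductivity.Theorems.KLRegimeSplit
open Summit.HubbardSuperconductivity.HubbardSuperconductivity.Theorems.TwoPointAssembly

/-! ## §1 The pointwise split (R) for two arbitrary volumes -/

section Pointwise

variable {L₁ M₁ L₂ M₂ : ℕ} [NeZero L₁] [NeZero M₁] [NeZero L₂] [NeZero M₂] {R : RenConsts} {β U μ c : ℝ}

/-- **(R) THE TWO-FRAME SPLIT OF THE FLOW READINGS OF TWO ARBITRARY VOLUMES `(L₁,M₁)`, `(L₂,M₂)`** (KL regime): for `0 ≤ Gfr`, `0 < c ≤ klCurveC3 R`,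
`0 < U ≤ klCurveU0 R`, `klBetaMin ≤ β ≤ e^{c/U²}`, `μ ∈ klWindowC`, the two flow frames `K_i = klFlowFrameU Lᵢ Mᵢ β U μ n` admissible, `t ≥ frameDist K₁ K₂`,
and a gradient bound `‖D(evalM S₁) q‖ ≤ b` (`b ≥ 0`) on the tube `{|e_{K₁}(q)| ≤ t}`, `S_i = symInterp Lᵢ (klLocSelfEnergyRe Lᵢ Mᵢ … K_i n)`:
`|ν_n^{(1)}(θ) − ν_n^{(2)}(θ)| ≤ |S₁(k_F^{K₂}θ) − S₂(k_F^{K₂}θ)| + b·frameDist K₁ K₂/klCurveD`. -/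
theorem abs_klLocalPart_flow_sub_le_commonPoint_add_vols (hR : ∀ j, 0 ≤ R.Gfr j) (hc : 0 < c) (hcle : c ≤ klCurveC3 R) (hU : 0 < U)
    (hUle : U ≤ klCurveU0 R) (hβmin : klBetaMin ≤ β) (hβc : β ≤ Real.exp (c / U ^ 2)) (hμ : μ ∈ klWindowC) {n : ℕ}
    (hK₁ : FrameOK R U (nScales β) μ (klFlowFrameU L₁ M₁ β U μ n)) (hK₂ : FrameOK R U (nScales β) μ (klFlowFrameU L₂ M₂ β U μ n))
    {t : ℝ} (ht : frameDist (klFlowFrameU L₁ M₁ β U μ n) (klFlowFrameU L₂ M₂ β U μ n) ≤ t) {b : ℝ} (hb : 0 ≤ b)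
    (hgrad : ∀ q : Momentum, |frameLevel μ (klFlowFrameU L₁ M₁ β U μ n) q| ≤ t →
      ‖fderiv ℝ (evalM (symInterp L₁ (klLocSelfEnergyRe L₁ M₁ β U μ (klFlowFrameU L₁ M₁ β U μ n) n))) q‖ ≤ b) (θ : ℝ) :
    |klLocalPart L₁ M₁ β U μ (klFlowFrameU L₁ M₁ β U μ n) n θ - klLocalPart L₂ M₂ β U μ (klFlowFrameU L₂ M₂ β U μ n) n θ| ≤
      |(symInterp L₁ (klLocSelfEnergyRe L₁ M₁ β U μ (klFlowFrameU L₁ M₁ β U μ n) n)).eval (klFermiPoint μ (klFlowFrameU L₂ M₂ β U μ n) θ) -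
          (symInterp L₂ (klLocSelfEnergyRe L₂ M₂ β U μ (klFlowFrameU L₂ M₂ β U μ n) n)).eval (klFermiPoint μ (klFlowFrameU L₂ M₂ β U μ n) θ)| +
        b * (frameDist (klFlowFrameU L₁ M₁ β U μ n) (klFlowFrameU L₂ M₂ β U μ n) / klCurveD) := by
  set K₁ := klFlowFrameU L₁ M₁ β U μ n with hK₁def
  set K₂ := klFlowFrameU L₂ M₂ β U μ n with hK₂def
  set S₁ := symInterp L₁ (klLocSelfEnergyRe L₁ M₁ β U μ K₁ n) with hS₁def
  set S₂ := symInterp L₂ (klLocSelfEnergyRe L₂ M₂ β U μ K₂ n) with hS₂def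
  obtain ⟨hA₁, -, hADt, hDle, ⟨hlo, hhi⟩, -, -⟩ := frame_sizes_of_frameOK_explicit hR hc hcle hU hUle hβmin hβc hμ hK₁
  obtain ⟨hA₂, -, -, -, -, -, -⟩ := frame_sizes_of_frameOK_explicit hR hc hcle hU hUle hβmin hβc hμ hK₂
  set B := bandBounds (show (-4 : ℝ) < -1.1 by norm_num) (show (-1.1 : ℝ) ≤ -0.1 by norm_num) (show (-0.1 : ℝ) < 0 by norm_num) with hBdef
  have hDpos : 0 < klCurveD := by unfold klCurveD; linarith [cDtmin_window_ge]
  have hgrad' : ∀ q : Momentum, |frameLevel μ K₁ q| ≤ frameDist K₁ K₂ → ‖fderiv ℝ (onM S₁.eval) q‖ ≤ b := fun q hq => by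
    rw [onM_eval]; exact hgrad q (hq.trans ht)
  have hsplit := abs_apply_klFermiPoint_sub_le_of_frames_of_tube B hA₁ hA₂ hADt hlo hhi S₁.eval S₂.eval
    (by rw [onM_eval]; exact differentiable_evalM S₁) hb θ hgrad'
  have hloc₁ : klLocalPart L₁ M₁ β U μ K₁ n θ = S₁.eval (klFermiPoint μ K₁ θ) := rfl
  have hloc₂ : klLocalPart L₂ M₂ β U μ K₂ n θ = S₂.eval (klFermiPoint μ K₂ θ) := rfl
  rw [hloc₁, hloc₂]
  refine hsplit.trans (add_le_add le_rfl (mul_le_mul_of_nonneg_left ?_ hb))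
  exact div_le_div_of_nonneg_left (frameDist_nonneg K₁ K₂) hDpos hDle

end Pointwise

/-! ## §2 STEP(n) of the cutoff nested leg from the two point estimates (R), (D) and the budget line -/

section Step

variable {L : ℕ} {hist : (L' M' : ℕ) → [NeZero L'] → [NeZero M'] → ℕ → Prop} {Q : EngConsts} {R : RenConsts} {β U μ c : ℝ}

/-- **STEP(n) OF THE CUTOFF NESTED LEG FROM TWO POINT ESTIMATES**, arbitrary comparison history (KL regime: `0 ≤ Gfr`, `0 < c ≤ klCurveC3 R`,
`0 < U ≤ klCurveU0 R`, `klBetaMin ≤ β ≤ e^{c/U²}`, `μ ∈ klWindowC`).  Inputs, each under STEP(n)'s own binders (thresholds `L ≤ L₁`, `Q.M0 β L₁ ≤ M₁`,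
`Mq L₁ ≤ M₁`, `M₁ ≤ M₂`, both histories below `n`, the leg's rates `a m/L₁` at `m < n`, the frame comparability `|K₁(q) − K₂(q)| ≤ F_n/L₁`,
`F_n = Σ_{m<n} a m`, `K_i = klFlowFrameU L₁ Mᵢ β U μ n`): `hKOK` — the flow frames of the comparison volumes at scale `n` are admissible (for
`histV17F2 ∧ slopes`: `frameOK_klFlowFrameU_of_histV17F2`); (R) `hgrad` — `‖D(evalM S₁) q‖ ≤ b` on the tube `{|e_{K₁}(q)| ≤ F_n/L₁}`; (D) `hD` —
`|S₁(k_F^{K₂}θ) − S₂(k_F^{K₂}θ)| ≤ d/L₁`; budget `b·F_n/klCurveD + d ≤ a n`.  Conclusion: STEP(n) in the shape consumed by `cutLeg_allScales_of_step_hist`. -/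
theorem cutLeg_step_of_pointDefect_hist (hR : ∀ j, 0 ≤ R.Gfr j) (hc : 0 < c) (hcle : c ≤ klCurveC3 R) (hU : 0 < U)
    (hUle : U ≤ klCurveU0 R) (hβmin : klBetaMin ≤ β) (hβc : β ≤ Real.exp (c / U ^ 2)) (hμ : μ ∈ klWindowC) {n : ℕ} {a : ℕ → ℝ}
    {b d : ℝ} (hb : 0 ≤ b)
    (hKOK : ∀ (L' M' : ℕ) [NeZero L'] [NeZero M'], L ≤ L' → Q.M0 β L' ≤ M' → (∀ j < n, hist L' M' j) →
      FrameOK R U (nScales β) μ (klFlowFrameU L' M' β U μ n))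
    (hgrad : ∀ (Mq : ℕ → ℕ) (L₁ M₁ M₂ : ℕ) [NeZero L₁] [NeZero M₁] [NeZero M₂], L ≤ L₁ → Q.M0 β L₁ ≤ M₁ → Mq L₁ ≤ M₁ → M₁ ≤ M₂ →
      (∀ j < n, hist L₁ M₁ j) → (∀ j < n, hist L₁ M₂ j) →
      (∀ m < n, ∀ θ : ℝ, |klLocalPart L₁ M₁ β U μ (klFlowFrameU L₁ M₁ β U μ m) m θ -
        klLocalPart L₁ M₂ β U μ (klFlowFrameU L₁ M₂ β U μ m) m θ| ≤ a m / L₁) →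
      (∀ q : Fin 2 → ℝ, |(klFlowFrameU L₁ M₁ β U μ n).eval q - (klFlowFrameU L₁ M₂ β U μ n).eval q| ≤ (∑ m ∈ range n, a m) / L₁) →
        ∀ q : Momentum, |frameLevel μ (klFlowFrameU L₁ M₁ β U μ n) q| ≤ (∑ m ∈ range n, a m) / L₁ →
          ‖fderiv ℝ (evalM (symInterp L₁ (klLocSelfEnergyRe L₁ M₁ β U μ (klFlowFrameU L₁ M₁ β U μ n) n))) q‖ ≤ b)
    (hD : ∀ (Mq : ℕ → ℕ) (L₁ M₁ M₂ : ℕ) [NeZero L₁] [NeZero M₁] [NeZero M₂], L ≤ L₁ → Q.M0 β L₁ ≤ M₁ → Mq L₁ ≤ M₁ → M₁ ≤ M₂ →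
      (∀ j < n, hist L₁ M₁ j) → (∀ j < n, hist L₁ M₂ j) →
      (∀ m < n, ∀ θ : ℝ, |klLocalPart L₁ M₁ β U μ (klFlowFrameU L₁ M₁ β U μ m) m θ -
        klLocalPart L₁ M₂ β U μ (klFlowFrameU L₁ M₂ β U μ m) m θ| ≤ a m / L₁) →
      (∀ q : Fin 2 → ℝ, |(klFlowFrameU L₁ M₁ β U μ n).eval q - (klFlowFrameU L₁ M₂ β U μ n).eval q| ≤ (∑ m ∈ range n, a m) / L₁) →
        ∀ θ : ℝ, |(symInterp L₁ (klLocSelfEnergyRe L₁ M₁ β U μ (klFlowFrameU L₁ M₁ β U μ n) n)).eval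
              (klFermiPoint μ (klFlowFrameU L₁ M₂ β U μ n) θ) -
            (symInterp L₁ (klLocSelfEnergyRe L₁ M₂ β U μ (klFlowFrameU L₁ M₂ β U μ n) n)).eval
              (klFermiPoint μ (klFlowFrameU L₁ M₂ β U μ n) θ)| ≤ d / L₁)
    (hbudget : b * (∑ m ∈ range n, a m) / klCurveD + d ≤ a n) :
    ∀ (Mq : ℕ → ℕ) (L₁ M₁ M₂ : ℕ) [NeZero L₁] [NeZero M₁] [NeZero M₂], L ≤ L₁ → Q.M0 β L₁ ≤ M₁ → Mq L₁ ≤ M₁ → M₁ ≤ M₂ →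
      (∀ j < n, hist L₁ M₁ j) → (∀ j < n, hist L₁ M₂ j) →
      (∀ m < n, ∀ θ : ℝ, |klLocalPart L₁ M₁ β U μ (klFlowFrameU L₁ M₁ β U μ m) m θ -
        klLocalPart L₁ M₂ β U μ (klFlowFrameU L₁ M₂ β U μ m) m θ| ≤ a m / L₁) →
      (∀ q : Fin 2 → ℝ, |(klFlowFrameU L₁ M₁ β U μ n).eval q - (klFlowFrameU L₁ M₂ β U μ n).eval q| ≤ (∑ m ∈ range n, a m) / L₁) →
        ∀ θ : ℝ, |klLocalPart L₁ M₁ β U μ (klFlowFrameU L₁ M₁ β U μ n) n θ -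
          klLocalPart L₁ M₂ β U μ (klFlowFrameU L₁ M₂ β U μ n) n θ| ≤ a n / L₁ := by
  intro Mq L₁ M₁ M₂ _ _ _ hLL₁ hM₁ hMq₁ hM₁₂ hh₁ hh₂ hrates hframe θ
  have hL₁0 : (0 : ℝ) < L₁ := by exact_mod_cast Nat.pos_of_ne_zero (NeZero.ne L₁)
  have hM₂ : Q.M0 β L₁ ≤ M₂ := hM₁.trans hM₁₂
  have hK₁ := hKOK L₁ M₁ hLL₁ hM₁ hh₁
  have hK₂ := hKOK L₁ M₂ hLL₁ hM₂ hh₂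
  have hDpos : 0 < klCurveD := by unfold klCurveD; linarith [cDtmin_window_ge]
  set F : ℝ := ∑ m ∈ range n, a m with hFdef
  have hfd : frameDist (klFlowFrameU L₁ M₁ β U μ n) (klFlowFrameU L₁ M₂ β U μ n) ≤ F / L₁ := frameDist_le_of_forall hframe
  have h1 := abs_klLocalPart_flow_sub_le_commonPoint_add_vols (L₁ := L₁) (M₁ := M₁) (L₂ := L₁) (M₂ := M₂) hR hc hcle hU hUle hβmin hβc hμ
    hK₁ hK₂ hfd hb (hgrad Mq L₁ M₁ M₂ hLL₁ hM₁ hMq₁ hM₁₂ hh₁ hh₂ hrates hframe) θ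
  have h2 := hD Mq L₁ M₁ M₂ hLL₁ hM₁ hMq₁ hM₁₂ hh₁ hh₂ hrates hframe θ
  have h3 : b * (frameDist (klFlowFrameU L₁ M₁ β U μ n) (klFlowFrameU L₁ M₂ β U μ n) / klCurveD) ≤ b * (F / L₁ / klCurveD) :=
    mul_le_mul_of_nonneg_left (div_le_div_of_nonneg_right hfd hDpos.le) hb
  have h4 : d / L₁ + b * (F / L₁ / klCurveD) = (b * F / klCurveD + d) / L₁ := by
    field_simp
    ring
  calc |klLocalPart L₁ M₁ β U μ (klFlowFrameU L₁ M₁ β U μ n) n θ - klLocalPart L₁ M₂ β U μ (klFlowFrameU L₁ M₂ β U μ n) n θ|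
      ≤ d / L₁ + b * (F / L₁ / klCurveD) := h1.trans (add_le_add h2 h3)
    _ = (b * F / klCurveD + d) / L₁ := h4
    _ ≤ a n / L₁ := div_le_div_of_nonneg_right hbudget hL₁0.le

/-- **STEP(n) WITH (R) IN ROW B2's CURRENCY**: the separated shell-tube gradient `m₁′` of the `(L₁, M₁)` volume's scale-`n` reading at its flow frame
(`‖D(evalM (symInterp L₁ (σ − K₁∘p))) q‖ ≤ m₁′` on `{|e_{K₁}(q)| ≤ Λ_n}`) and the side condition `F_n ≤ Λ_n·L` (the frame-distance tube of every
`L₁ ≥ L` sits inside the shell tube); then `b := m₁′ + 4/3·Gfr₁·U²` and the budget reads `(m₁′ + 4/3·Gfr₁U²)·F_n/klCurveD + d ≤ a n`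
(degree guard `klEngL₃ β U ≤ L`). -/
theorem cutLeg_step_of_pointDefect_sepTubeGradient_hist (hR : ∀ j, 0 ≤ R.Gfr j) (hc : 0 < c) (hcle : c ≤ klCurveC3 R) (hU : 0 < U)
    (hUle : U ≤ klCurveU0 R) (hβmin : klBetaMin ≤ β) (hβc : β ≤ Real.exp (c / U ^ 2)) (hμ : μ ∈ klWindowC) (hL : klEngL₃ β U ≤ L)
    {n : ℕ} (hn : n ≤ nScales β + 1) {a : ℕ → ℝ} (hFΛ : ∑ m ∈ range n, a m ≤ klScale klE0 n * L) {m₁' d : ℝ} (hm0 : 0 ≤ m₁')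
    (hKOK : ∀ (L' M' : ℕ) [NeZero L'] [NeZero M'], L ≤ L' → Q.M0 β L' ≤ M' → (∀ j < n, hist L' M' j) →
      FrameOK R U (nScales β) μ (klFlowFrameU L' M' β U μ n))
    (hm₁' : ∀ (Mq : ℕ → ℕ) (L₁ M₁ M₂ : ℕ) [NeZero L₁] [NeZero M₁] [NeZero M₂], L ≤ L₁ → Q.M0 β L₁ ≤ M₁ → Mq L₁ ≤ M₁ → M₁ ≤ M₂ →
      (∀ j < n, hist L₁ M₁ j) → (∀ j < n, hist L₁ M₂ j) →
      (∀ m < n, ∀ θ : ℝ, |klLocalPart L₁ M₁ β U μ (klFlowFrameU L₁ M₁ β U μ m) m θ -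
        klLocalPart L₁ M₂ β U μ (klFlowFrameU L₁ M₂ β U μ m) m θ| ≤ a m / L₁) →
      (∀ q : Fin 2 → ℝ, |(klFlowFrameU L₁ M₁ β U μ n).eval q - (klFlowFrameU L₁ M₂ β U μ n).eval q| ≤ (∑ m ∈ range n, a m) / L₁) →
        ∀ q : Momentum, |frameLevel μ (klFlowFrameU L₁ M₁ β U μ n) q| ≤ klScale klE0 n →
          ‖fderiv ℝ (evalM (symInterp L₁ (fun p => klLocSelfEnergyRe L₁ M₁ β U μ (klFlowFrameU L₁ M₁ β U μ n) n p -
            (klFlowFrameU L₁ M₁ β U μ n).eval (latticeMomentum L₁ p)))) q‖ ≤ m₁')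
    (hD : ∀ (Mq : ℕ → ℕ) (L₁ M₁ M₂ : ℕ) [NeZero L₁] [NeZero M₁] [NeZero M₂], L ≤ L₁ → Q.M0 β L₁ ≤ M₁ → Mq L₁ ≤ M₁ → M₁ ≤ M₂ →
      (∀ j < n, hist L₁ M₁ j) → (∀ j < n, hist L₁ M₂ j) →
      (∀ m < n, ∀ θ : ℝ, |klLocalPart L₁ M₁ β U μ (klFlowFrameU L₁ M₁ β U μ m) m θ -
        klLocalPart L₁ M₂ β U μ (klFlowFrameU L₁ M₂ β U μ m) m θ| ≤ a m / L₁) →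
      (∀ q : Fin 2 → ℝ, |(klFlowFrameU L₁ M₁ β U μ n).eval q - (klFlowFrameU L₁ M₂ β U μ n).eval q| ≤ (∑ m ∈ range n, a m) / L₁) →
        ∀ θ : ℝ, |(symInterp L₁ (klLocSelfEnergyRe L₁ M₁ β U μ (klFlowFrameU L₁ M₁ β U μ n) n)).eval
              (klFermiPoint μ (klFlowFrameU L₁ M₂ β U μ n) θ) -
            (symInterp L₁ (klLocSelfEnergyRe L₁ M₂ β U μ (klFlowFrameU L₁ M₂ β U μ n) n)).eval
              (klFermiPoint μ (klFlowFrameU L₁ M₂ β U μ n) θ)| ≤ d / L₁)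
    (hbudget : (m₁' + 4 / 3 * R.Gfr 1 * U ^ 2) * (∑ m ∈ range n, a m) / klCurveD + d ≤ a n) :
    ∀ (Mq : ℕ → ℕ) (L₁ M₁ M₂ : ℕ) [NeZero L₁] [NeZero M₁] [NeZero M₂], L ≤ L₁ → Q.M0 β L₁ ≤ M₁ → Mq L₁ ≤ M₁ → M₁ ≤ M₂ →
      (∀ j < n, hist L₁ M₁ j) → (∀ j < n, hist L₁ M₂ j) →
      (∀ m < n, ∀ θ : ℝ, |klLocalPart L₁ M₁ β U μ (klFlowFrameU L₁ M₁ β U μ m) m θ -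
        klLocalPart L₁ M₂ β U μ (klFlowFrameU L₁ M₂ β U μ m) m θ| ≤ a m / L₁) →
      (∀ q : Fin 2 → ℝ, |(klFlowFrameU L₁ M₁ β U μ n).eval q - (klFlowFrameU L₁ M₂ β U μ n).eval q| ≤ (∑ m ∈ range n, a m) / L₁) →
        ∀ θ : ℝ, |klLocalPart L₁ M₁ β U μ (klFlowFrameU L₁ M₁ β U μ n) n θ -
          klLocalPart L₁ M₂ β U μ (klFlowFrameU L₁ M₂ β U μ n) n θ| ≤ a n / L₁ := by
  have h13 : 0 ≤ 4 / 3 * R.Gfr 1 * U ^ 2 := by have := hR 1; positivity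
  refine cutLeg_step_of_pointDefect_hist hR hc hcle hU hUle hβmin hβc hμ (b := m₁' + 4 / 3 * R.Gfr 1 * U ^ 2) (by positivity) hKOK
    ?_ hD hbudget
  intro Mq L₁ M₁ M₂ _ _ _ hLL₁ hM₁ hMq₁ hM₁₂ hh₁ hh₂ hrates hframe q hq
  have hL₁0 : (0 : ℝ) < L₁ := by exact_mod_cast Nat.pos_of_ne_zero (NeZero.ne L₁)
  have hLL₁' : (L : ℝ) ≤ L₁ := by exact_mod_cast hLL₁
  have hK₁ := hKOK L₁ M₁ hLL₁ hM₁ hh₁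
  -- the frame-distance tube sits inside the shell tube
  have hΛ0 : 0 ≤ klScale klE0 n := by unfold klScale klE0; positivity
  have htube : (∑ m ∈ range n, a m) / L₁ ≤ klScale klE0 n := by
    rw [div_le_iff₀ hL₁0]
    exact hFΛ.trans (mul_le_mul_of_nonneg_left hLL₁' hΛ0)
  have hq' : |frameLevel μ (klFlowFrameU L₁ M₁ β U μ n) q| ≤ klScale klE0 n := hq.trans htube
  have hdeg : (klFlowFrameU L₁ M₁ β U μ n).degree ≤ L₁ / 2 :=
    (frameOKDeg_klFlowFrameU hK₁ hn).degree_le_half rfl hβmin (hL.trans hLL₁)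
  have hsep := hm₁' Mq L₁ M₁ M₂ hLL₁ hM₁ hMq₁ hM₁₂ hh₁ hh₂ hrates hframe q hq'
  refine (norm_fderiv_evalM_symInterp_le_of_sep_at (L := L₁) (M := M₁) hdeg β U μ n q hsep).trans ?_
  linarith [norm_iteratedFDeriv_one_frameShift_le_of_frameOK hR hK₁ q]

end Step

/-! ## §3 The cutoff leg at every scale `≤ N` from the per-scale point estimates -/

section AllScales

variable {L : ℕ} {hist : (L' M' : ℕ) → [NeZero L'] → [NeZero M'] → ℕ → Prop} {Q : EngConsts} {R : RenConsts} {β U μ c : ℝ}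

/-- **THE CUTOFF NESTED LEG AT ALL SCALES `n ≤ N` FROM PER-SCALE POINT ESTIMATES**, arbitrary comparison history yielding `C⁴` readings (`hC`):
`hKOK n`, (R) `hgrad n` with constants `b n ≥ 0` on the tube `{|e_{K₁}| ≤ F_n/L₁}`, (D) `hD n` with constants `d n`, and the budget
`b n·F_n/klCurveD + d n ≤ a n` at every `n ≤ N` ⟹ `|ν_n^{(1)} − ν_n^{(2)}| ≤ a n/L₁` in STEP's binder shape at every `n ≤ N`
(`cutLeg_allScales_of_step_hist` ∘ `cutLeg_step_of_pointDefect_hist`). -/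
theorem cutLeg_allScales_of_pointDefects_hist (hR : ∀ j, 0 ≤ R.Gfr j) (hc : 0 < c) (hcle : c ≤ klCurveC3 R) (hU : 0 < U)
    (hUle : U ≤ klCurveU0 R) (hβmin : klBetaMin ≤ β) (hβc : β ≤ Real.exp (c / U ^ 2)) (hμ : μ ∈ klWindowC)
    (hC : ∀ (L' M' : ℕ) [NeZero L'] [NeZero M'] (j : ℕ), hist L' M' j →
      ContDiff ℝ 4 (fun θ : ℝ => klLocalPart L' M' β U μ (klFlowFrameU L' M' β U μ j) j θ))
    {N : ℕ} {a b d : ℕ → ℝ} (hb : ∀ n ≤ N, 0 ≤ b n)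
    (hKOK : ∀ n ≤ N, ∀ (L' M' : ℕ) [NeZero L'] [NeZero M'], L ≤ L' → Q.M0 β L' ≤ M' → (∀ j < n, hist L' M' j) →
      FrameOK R U (nScales β) μ (klFlowFrameU L' M' β U μ n))
    (hgrad : ∀ n ≤ N, ∀ (Mq : ℕ → ℕ) (L₁ M₁ M₂ : ℕ) [NeZero L₁] [NeZero M₁] [NeZero M₂], L ≤ L₁ → Q.M0 β L₁ ≤ M₁ → Mq L₁ ≤ M₁ →
      M₁ ≤ M₂ → (∀ j < n, hist L₁ M₁ j) → (∀ j < n, hist L₁ M₂ j) →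
      (∀ m < n, ∀ θ : ℝ, |klLocalPart L₁ M₁ β U μ (klFlowFrameU L₁ M₁ β U μ m) m θ -
        klLocalPart L₁ M₂ β U μ (klFlowFrameU L₁ M₂ β U μ m) m θ| ≤ a m / L₁) →
      (∀ q : Fin 2 → ℝ, |(klFlowFrameU L₁ M₁ β U μ n).eval q - (klFlowFrameU L₁ M₂ β U μ n).eval q| ≤ (∑ m ∈ range n, a m) / L₁) →
        ∀ q : Momentum, |frameLevel μ (klFlowFrameU L₁ M₁ β U μ n) q| ≤ (∑ m ∈ range n, a m) / L₁ →
          ‖fderiv ℝ (evalM (symInterp L₁ (klLocSelfEnergyRe L₁ M₁ β U μ (klFlowFrameU L₁ M₁ β U μ n) n))) q‖ ≤ b n)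
    (hD : ∀ n ≤ N, ∀ (Mq : ℕ → ℕ) (L₁ M₁ M₂ : ℕ) [NeZero L₁] [NeZero M₁] [NeZero M₂], L ≤ L₁ → Q.M0 β L₁ ≤ M₁ → Mq L₁ ≤ M₁ →
      M₁ ≤ M₂ → (∀ j < n, hist L₁ M₁ j) → (∀ j < n, hist L₁ M₂ j) →
      (∀ m < n, ∀ θ : ℝ, |klLocalPart L₁ M₁ β U μ (klFlowFrameU L₁ M₁ β U μ m) m θ -
        klLocalPart L₁ M₂ β U μ (klFlowFrameU L₁ M₂ β U μ m) m θ| ≤ a m / L₁) →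
      (∀ q : Fin 2 → ℝ, |(klFlowFrameU L₁ M₁ β U μ n).eval q - (klFlowFrameU L₁ M₂ β U μ n).eval q| ≤ (∑ m ∈ range n, a m) / L₁) →
        ∀ θ : ℝ, |(symInterp L₁ (klLocSelfEnergyRe L₁ M₁ β U μ (klFlowFrameU L₁ M₁ β U μ n) n)).eval
              (klFermiPoint μ (klFlowFrameU L₁ M₂ β U μ n) θ) -
            (symInterp L₁ (klLocSelfEnergyRe L₁ M₂ β U μ (klFlowFrameU L₁ M₂ β U μ n) n)).eval
              (klFermiPoint μ (klFlowFrameU L₁ M₂ β U μ n) θ)| ≤ d n / L₁)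
    (hbudget : ∀ n ≤ N, b n * (∑ m ∈ range n, a m) / klCurveD + d n ≤ a n) :
    ∀ n ≤ N, ∀ (Mq : ℕ → ℕ) (L₁ M₁ M₂ : ℕ) [NeZero L₁] [NeZero M₁] [NeZero M₂], L ≤ L₁ → Q.M0 β L₁ ≤ M₁ → Mq L₁ ≤ M₁ → M₁ ≤ M₂ →
      (∀ j < n, hist L₁ M₁ j) → (∀ j < n, hist L₁ M₂ j) →
        ∀ θ : ℝ, |klLocalPart L₁ M₁ β U μ (klFlowFrameU L₁ M₁ β U μ n) n θ -
          klLocalPart L₁ M₂ β U μ (klFlowFrameU L₁ M₂ β U μ n) n θ| ≤ a n / L₁ :=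
  cutLeg_allScales_of_step_hist hμ hC fun n hn =>
    cutLeg_step_of_pointDefect_hist hR hc hcle hU hUle hβmin hβc hμ (hb n hn) (hKOK n hn) (hgrad n hn) (hD n hn) (hbudget n hn)

end AllScales

/-! ## §4 The rev-2 bundle: `hist := histV17F2 ∧ TwoLegSlopes` — the `hcut` of the (e)/(M) closers (quarter budget, package thresholds, private rates) -/

section V17F2

variable {L : ℕ} {G : GeoConsts} {P : SplitConsts} {Q : EngConsts} {R : RenConsts} {β U μ c : ℝ}

/-- **ROW C1 (`hcut`) OF `stub_twoLeg_step_of_residuals*` / `twoLegStepV17F2_of_jets_…_nestedLegs` AT EVERY SCALE `n ≤ N ≤ nScales β + 1` FROM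
PER-SCALE POINT ESTIMATES ON PRIVATE RATES `a`**, closed to the public quarter budget by `a n ≤ Q.CL β n / 4` (KL regime, `0 ≤ Gfr`, bare frame
admissible `h0` — the stub's frame binder read at scale `0`, `klFlowFrameU_zero`, or `klFrameOK_zeroC`; the comparison volumes' flow frames are then
admissible by `frameOK_klFlowFrameU_of_histV17F2`): (R) `hgrad`, (D) `hD` and the budget `b n·(Σ_{m<n} a m)/klCurveD + d n ≤ a n` are stated with the
PRIVATE rates below `n` in their binders; the conclusion is the literal `hcut` hypothesis (history `histV17F2 ∧ TwoLegSlopes` at `(G, P, Q, R)`). -/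
theorem cutLeg_allScales_of_pointDefects_V17F2_rates (hR : ∀ j, 0 ≤ R.Gfr j) (hc : 0 < c) (hcle : c ≤ klCurveC3 R) (hU : 0 < U)
    (hUle : U ≤ klCurveU0 R) (hβmin : klBetaMin ≤ β) (hβc : β ≤ Real.exp (c / U ^ 2)) (hμ : μ ∈ klWindowC)
    (h0 : FrameOK R U (nScales β) μ 0) {N : ℕ} (hN : N ≤ nScales β + 1) {a b d : ℕ → ℝ} (ha : ∀ n ≤ N, a n ≤ Q.CL β n / 4)
    (hb : ∀ n ≤ N, 0 ≤ b n)
    (hgrad : ∀ n ≤ N, ∀ (Mq : ℕ → ℕ) (L₁ M₁ M₂ : ℕ) [NeZero L₁] [NeZero M₁] [NeZero M₂], L ≤ L₁ → Q.M0 β L₁ ≤ M₁ → Mq L₁ ≤ M₁ →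
      M₁ ≤ M₂ →
      (∀ j < n, histV17F2 L₁ M₁ G P Q R β U μ j ∧ TwoLegSlopes L₁ M₁ R β U μ (klFlowFrameU L₁ M₁ β U μ j) j) →
      (∀ j < n, histV17F2 L₁ M₂ G P Q R β U μ j ∧ TwoLegSlopes L₁ M₂ R β U μ (klFlowFrameU L₁ M₂ β U μ j) j) →
      (∀ m < n, ∀ θ : ℝ, |klLocalPart L₁ M₁ β U μ (klFlowFrameU L₁ M₁ β U μ m) m θ -
        klLocalPart L₁ M₂ β U μ (klFlowFrameU L₁ M₂ β U μ m) m θ| ≤ a m / L₁) →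
      (∀ q : Fin 2 → ℝ, |(klFlowFrameU L₁ M₁ β U μ n).eval q - (klFlowFrameU L₁ M₂ β U μ n).eval q| ≤ (∑ m ∈ range n, a m) / L₁) →
        ∀ q : Momentum, |frameLevel μ (klFlowFrameU L₁ M₁ β U μ n) q| ≤ (∑ m ∈ range n, a m) / L₁ →
          ‖fderiv ℝ (evalM (symInterp L₁ (klLocSelfEnergyRe L₁ M₁ β U μ (klFlowFrameU L₁ M₁ β U μ n) n))) q‖ ≤ b n)
    (hD : ∀ n ≤ N, ∀ (Mq : ℕ → ℕ) (L₁ M₁ M₂ : ℕ) [NeZero L₁] [NeZero M₁] [NeZero M₂], L ≤ L₁ → Q.M0 β L₁ ≤ M₁ → Mq L₁ ≤ M₁ →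
      M₁ ≤ M₂ →
      (∀ j < n, histV17F2 L₁ M₁ G P Q R β U μ j ∧ TwoLegSlopes L₁ M₁ R β U μ (klFlowFrameU L₁ M₁ β U μ j) j) →
      (∀ j < n, histV17F2 L₁ M₂ G P Q R β U μ j ∧ TwoLegSlopes L₁ M₂ R β U μ (klFlowFrameU L₁ M₂ β U μ j) j) →
      (∀ m < n, ∀ θ : ℝ, |klLocalPart L₁ M₁ β U μ (klFlowFrameU L₁ M₁ β U μ m) m θ -
        klLocalPart L₁ M₂ β U μ (klFlowFrameU L₁ M₂ β U μ m) m θ| ≤ a m / L₁) →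
      (∀ q : Fin 2 → ℝ, |(klFlowFrameU L₁ M₁ β U μ n).eval q - (klFlowFrameU L₁ M₂ β U μ n).eval q| ≤ (∑ m ∈ range n, a m) / L₁) →
        ∀ θ : ℝ, |(symInterp L₁ (klLocSelfEnergyRe L₁ M₁ β U μ (klFlowFrameU L₁ M₁ β U μ n) n)).eval
              (klFermiPoint μ (klFlowFrameU L₁ M₂ β U μ n) θ) -
            (symInterp L₁ (klLocSelfEnergyRe L₁ M₂ β U μ (klFlowFrameU L₁ M₂ β U μ n) n)).eval
              (klFermiPoint μ (klFlowFrameU L₁ M₂ β U μ n) θ)| ≤ d n / L₁)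
    (hbudget : ∀ n ≤ N, b n * (∑ m ∈ range n, a m) / klCurveD + d n ≤ a n) :
    ∀ n ≤ N, ∀ (Mq : ℕ → ℕ) (L₁ M₁ M₂ : ℕ) [NeZero L₁] [NeZero M₁] [NeZero M₂], L ≤ L₁ → Q.M0 β L₁ ≤ M₁ → Mq L₁ ≤ M₁ → M₁ ≤ M₂ →
      (∀ j < n, histV17F2 L₁ M₁ G P Q R β U μ j ∧ TwoLegSlopes L₁ M₁ R β U μ (klFlowFrameU L₁ M₁ β U μ j) j) →
      (∀ j < n, histV17F2 L₁ M₂ G P Q R β U μ j ∧ TwoLegSlopes L₁ M₂ R β U μ (klFlowFrameU L₁ M₂ β U μ j) j) →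
        ∀ θ : ℝ, |klLocalPart L₁ M₁ β U μ (klFlowFrameU L₁ M₁ β U μ n) n θ -
          klLocalPart L₁ M₂ β U μ (klFlowFrameU L₁ M₂ β U μ n) n θ| ≤ Q.CL β n / 4 / L₁ := by
  intro n hn Mq L₁ M₁ M₂ _ _ _ hLL₁ hM₁ hMq₁ hM₁₂ hh₁ hh₂ θ
  have hL₁0 : (0 : ℝ) < L₁ := by exact_mod_cast Nat.pos_of_ne_zero (NeZero.ne L₁)
  have h := cutLeg_allScales_of_pointDefects_hist (a := a)
    (hist := fun L'' M'' _ _ j => histV17F2 L'' M'' G P Q R β U μ j ∧ TwoLegSlopes L'' M'' R β U μ (klFlowFrameU L'' M'' β U μ j) j)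
    hR hc hcle hU hUle hβmin hβc hμ (fun L' M' _ _ j h => histV17F2_slopes_contDiff L' M' j h) hb
    (fun _ hn _ _ _ _ _ _ h => frameOK_klFlowFrameU_of_histV17F2 hR h0 (hn.trans hN) h) hgrad hD hbudget
    n hn Mq L₁ M₁ M₂ hLL₁ hM₁ hMq₁ hM₁₂ hh₁ hh₂ θ
  exact h.trans (div_le_div_of_nonneg_right (ha n hn) hL₁0.le)

/-- **ROW C1 (`hcut`) AT EVERY SCALE FROM PER-SCALE POINT ESTIMATES ON THE PUBLIC QUARTER BUDGET** `a m := Q.CL β m / 4` (the `M₁ = M₂`-free twin of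
`spLeg_allScales_of_pointDefects_V17F2`; for the record — at deep scales the private-rates form above is the vehicle). -/
theorem cutLeg_allScales_of_pointDefects_V17F2 (hR : ∀ j, 0 ≤ R.Gfr j) (hc : 0 < c) (hcle : c ≤ klCurveC3 R) (hU : 0 < U)
    (hUle : U ≤ klCurveU0 R) (hβmin : klBetaMin ≤ β) (hβc : β ≤ Real.exp (c / U ^ 2)) (hμ : μ ∈ klWindowC)
    (h0 : FrameOK R U (nScales β) μ 0) {N : ℕ} (hN : N ≤ nScales β + 1) {b d : ℕ → ℝ}
    (hb : ∀ n ≤ N, 0 ≤ b n)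
    (hgrad : ∀ n ≤ N, ∀ (Mq : ℕ → ℕ) (L₁ M₁ M₂ : ℕ) [NeZero L₁] [NeZero M₁] [NeZero M₂], L ≤ L₁ → Q.M0 β L₁ ≤ M₁ → Mq L₁ ≤ M₁ →
      M₁ ≤ M₂ →
      (∀ j < n, histV17F2 L₁ M₁ G P Q R β U μ j ∧ TwoLegSlopes L₁ M₁ R β U μ (klFlowFrameU L₁ M₁ β U μ j) j) →
      (∀ j < n, histV17F2 L₁ M₂ G P Q R β U μ j ∧ TwoLegSlopes L₁ M₂ R β U μ (klFlowFrameU L₁ M₂ β U μ j) j) →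
      (∀ m < n, ∀ θ : ℝ, |klLocalPart L₁ M₁ β U μ (klFlowFrameU L₁ M₁ β U μ m) m θ -
        klLocalPart L₁ M₂ β U μ (klFlowFrameU L₁ M₂ β U μ m) m θ| ≤ Q.CL β m / 4 / L₁) →
      (∀ q : Fin 2 → ℝ, |(klFlowFrameU L₁ M₁ β U μ n).eval q - (klFlowFrameU L₁ M₂ β U μ n).eval q| ≤
        (∑ m ∈ range n, Q.CL β m / 4) / L₁) →
        ∀ q : Momentum, |frameLevel μ (klFlowFrameU L₁ M₁ β U μ n) q| ≤ (∑ m ∈ range n, Q.CL β m / 4) / L₁ →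
          ‖fderiv ℝ (evalM (symInterp L₁ (klLocSelfEnergyRe L₁ M₁ β U μ (klFlowFrameU L₁ M₁ β U μ n) n))) q‖ ≤ b n)
    (hD : ∀ n ≤ N, ∀ (Mq : ℕ → ℕ) (L₁ M₁ M₂ : ℕ) [NeZero L₁] [NeZero M₁] [NeZero M₂], L ≤ L₁ → Q.M0 β L₁ ≤ M₁ → Mq L₁ ≤ M₁ →
      M₁ ≤ M₂ →
      (∀ j < n, histV17F2 L₁ M₁ G P Q R β U μ j ∧ TwoLegSlopes L₁ M₁ R β U μ (klFlowFrameU L₁ M₁ β U μ j) j) →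
      (∀ j < n, histV17F2 L₁ M₂ G P Q R β U μ j ∧ TwoLegSlopes L₁ M₂ R β U μ (klFlowFrameU L₁ M₂ β U μ j) j) →
      (∀ m < n, ∀ θ : ℝ, |klLocalPart L₁ M₁ β U μ (klFlowFrameU L₁ M₁ β U μ m) m θ -
        klLocalPart L₁ M₂ β U μ (klFlowFrameU L₁ M₂ β U μ m) m θ| ≤ Q.CL β m / 4 / L₁) →
      (∀ q : Fin 2 → ℝ, |(klFlowFrameU L₁ M₁ β U μ n).eval q - (klFlowFrameU L₁ M₂ β U μ n).eval q| ≤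
        (∑ m ∈ range n, Q.CL β m / 4) / L₁) →
        ∀ θ : ℝ, |(symInterp L₁ (klLocSelfEnergyRe L₁ M₁ β U μ (klFlowFrameU L₁ M₁ β U μ n) n)).eval
              (klFermiPoint μ (klFlowFrameU L₁ M₂ β U μ n) θ) -
            (symInterp L₁ (klLocSelfEnergyRe L₁ M₂ β U μ (klFlowFrameU L₁ M₂ β U μ n) n)).eval
              (klFermiPoint μ (klFlowFrameU L₁ M₂ β U μ n) θ)| ≤ d n / L₁)
    (hbudget : ∀ n ≤ N, b n * (∑ m ∈ range n, Q.CL β m / 4) / klCurveD + d n ≤ Q.CL β n / 4) :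
    ∀ n ≤ N, ∀ (Mq : ℕ → ℕ) (L₁ M₁ M₂ : ℕ) [NeZero L₁] [NeZero M₁] [NeZero M₂], L ≤ L₁ → Q.M0 β L₁ ≤ M₁ → Mq L₁ ≤ M₁ → M₁ ≤ M₂ →
      (∀ j < n, histV17F2 L₁ M₁ G P Q R β U μ j ∧ TwoLegSlopes L₁ M₁ R β U μ (klFlowFrameU L₁ M₁ β U μ j) j) →
      (∀ j < n, histV17F2 L₁ M₂ G P Q R β U μ j ∧ TwoLegSlopes L₁ M₂ R β U μ (klFlowFrameU L₁ M₂ β U μ j) j) →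
        ∀ θ : ℝ, |klLocalPart L₁ M₁ β U μ (klFlowFrameU L₁ M₁ β U μ n) n θ -
          klLocalPart L₁ M₂ β U μ (klFlowFrameU L₁ M₂ β U μ n) n θ| ≤ Q.CL β n / 4 / L₁ :=
  cutLeg_allScales_of_pointDefects_hist (a := fun m => Q.CL β m / 4)
    (hist := fun L'' M'' _ _ j => histV17F2 L'' M'' G P Q R β U μ j ∧ TwoLegSlopes L'' M'' R β U μ (klFlowFrameU L'' M'' β U μ j) j)
    hR hc hcle hU hUle hβmin hβc hμ (fun L' M' _ _ j h => histV17F2_slopes_contDiff L' M' j h) hb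
    (fun _ hn _ _ _ _ _ _ h => frameOK_klFlowFrameU_of_histV17F2 hR h0 (hn.trans hN) h) hgrad hD hbudget

/-- **The same under the engine's thresholds** (`R.WF2`, `c ≤ klEngC₃3 P R`, `U ≤ klEngU₀4 P R c`; a raised package threshold composes by `le_trans`,
e.g. `klEngU₀9/10 ≤ klEngU₀4`, `klEngC₃6 ≤ klEngC₃3`; `h0` = the (e)/(M) stub's frame binder read at scale `0`, `klFlowFrameU_zero`, or `klFrameOK_zeroC hR.1 U _ hμ`),
PRIVATE rates `a n ≤ Q.CL β n / 4`. -/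
theorem cutLeg_allScales_of_pointDefects_V17F2_rates_pkg (P : SplitConsts) (hR : R.WF2) (hc : 0 < c) (hc3 : c ≤ klEngC₃3 P R) (hU : 0 < U)
    (hUle : U ≤ klEngU₀4 P R c) (hβmin : klBetaMin ≤ β) (hβc : β ≤ Real.exp (c / U ^ 2)) (hμ : μ ∈ klWindowC)
    (h0 : FrameOK R U (nScales β) μ 0) {N : ℕ} (hN : N ≤ nScales β + 1) {a b d : ℕ → ℝ} (ha : ∀ n ≤ N, a n ≤ Q.CL β n / 4)
    (hb : ∀ n ≤ N, 0 ≤ b n)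
    (hgrad : ∀ n ≤ N, ∀ (Mq : ℕ → ℕ) (L₁ M₁ M₂ : ℕ) [NeZero L₁] [NeZero M₁] [NeZero M₂], L ≤ L₁ → Q.M0 β L₁ ≤ M₁ → Mq L₁ ≤ M₁ →
      M₁ ≤ M₂ →
      (∀ j < n, histV17F2 L₁ M₁ G P Q R β U μ j ∧ TwoLegSlopes L₁ M₁ R β U μ (klFlowFrameU L₁ M₁ β U μ j) j) →
      (∀ j < n, histV17F2 L₁ M₂ G P Q R β U μ j ∧ TwoLegSlopes L₁ M₂ R β U μ (klFlowFrameU L₁ M₂ β U μ j) j) →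
      (∀ m < n, ∀ θ : ℝ, |klLocalPart L₁ M₁ β U μ (klFlowFrameU L₁ M₁ β U μ m) m θ -
        klLocalPart L₁ M₂ β U μ (klFlowFrameU L₁ M₂ β U μ m) m θ| ≤ a m / L₁) →
      (∀ q : Fin 2 → ℝ, |(klFlowFrameU L₁ M₁ β U μ n).eval q - (klFlowFrameU L₁ M₂ β U μ n).eval q| ≤ (∑ m ∈ range n, a m) / L₁) →
        ∀ q : Momentum, |frameLevel μ (klFlowFrameU L₁ M₁ β U μ n) q| ≤ (∑ m ∈ range n, a m) / L₁ →
          ‖fderiv ℝ (evalM (symInterp L₁ (klLocSelfEnergyRe L₁ M₁ β U μ (klFlowFrameU L₁ M₁ β U μ n) n))) q‖ ≤ b n)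
    (hD : ∀ n ≤ N, ∀ (Mq : ℕ → ℕ) (L₁ M₁ M₂ : ℕ) [NeZero L₁] [NeZero M₁] [NeZero M₂], L ≤ L₁ → Q.M0 β L₁ ≤ M₁ → Mq L₁ ≤ M₁ →
      M₁ ≤ M₂ →
      (∀ j < n, histV17F2 L₁ M₁ G P Q R β U μ j ∧ TwoLegSlopes L₁ M₁ R β U μ (klFlowFrameU L₁ M₁ β U μ j) j) →
      (∀ j < n, histV17F2 L₁ M₂ G P Q R β U μ j ∧ TwoLegSlopes L₁ M₂ R β U μ (klFlowFrameU L₁ M₂ β U μ j) j) →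
      (∀ m < n, ∀ θ : ℝ, |klLocalPart L₁ M₁ β U μ (klFlowFrameU L₁ M₁ β U μ m) m θ -
        klLocalPart L₁ M₂ β U μ (klFlowFrameU L₁ M₂ β U μ m) m θ| ≤ a m / L₁) →
      (∀ q : Fin 2 → ℝ, |(klFlowFrameU L₁ M₁ β U μ n).eval q - (klFlowFrameU L₁ M₂ β U μ n).eval q| ≤ (∑ m ∈ range n, a m) / L₁) →
        ∀ θ : ℝ, |(symInterp L₁ (klLocSelfEnergyRe L₁ M₁ β U μ (klFlowFrameU L₁ M₁ β U μ n) n)).eval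
              (klFermiPoint μ (klFlowFrameU L₁ M₂ β U μ n) θ) -
            (symInterp L₁ (klLocSelfEnergyRe L₁ M₂ β U μ (klFlowFrameU L₁ M₂ β U μ n) n)).eval
              (klFermiPoint μ (klFlowFrameU L₁ M₂ β U μ n) θ)| ≤ d n / L₁)
    (hbudget : ∀ n ≤ N, b n * (∑ m ∈ range n, a m) / klCurveD + d n ≤ a n) :
    ∀ n ≤ N, ∀ (Mq : ℕ → ℕ) (L₁ M₁ M₂ : ℕ) [NeZero L₁] [NeZero M₁] [NeZero M₂], L ≤ L₁ → Q.M0 β L₁ ≤ M₁ → Mq L₁ ≤ M₁ → M₁ ≤ M₂ →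
      (∀ j < n, histV17F2 L₁ M₁ G P Q R β U μ j ∧ TwoLegSlopes L₁ M₁ R β U μ (klFlowFrameU L₁ M₁ β U μ j) j) →
      (∀ j < n, histV17F2 L₁ M₂ G P Q R β U μ j ∧ TwoLegSlopes L₁ M₂ R β U μ (klFlowFrameU L₁ M₂ β U μ j) j) →
        ∀ θ : ℝ, |klLocalPart L₁ M₁ β U μ (klFlowFrameU L₁ M₁ β U μ n) n θ -
          klLocalPart L₁ M₂ β U μ (klFlowFrameU L₁ M₂ β U μ n) n θ| ≤ Q.CL β n / 4 / L₁ :=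
  have hR' : ∀ j, 0 ≤ R.Gfr j := hR.1.2.2
  cutLeg_allScales_of_pointDefects_V17F2_rates hR' hc (hc3.trans (klEngC₃3_le_klCurveC3 P hR')) hU
    ((le_klEngU₀3_of_le_klEngU₀4 hUle).trans (klEngU₀3_le_klCurveU0 P hR' c)) hβmin hβc hμ h0 hN ha hb hgrad hD hbudget

end V17F2

end Summit.HubbardSuperconductivity.HubbardSuperconductivity.Theorems.EngineV8

end
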